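import Summits.NavierStokesRegularity.NavierStokesRegularity.Theorems.QuietScarPocketDoorLPocketDefs
import Summits.NavierStokesRegularity.NavierStokesRegularity.Theorems.QuietScarPocketDoorStrainRigidity

/-!
# QuietScarPocketDoorLStrainRigidity — §B «L-pocket schema» (texts `QuietScarPocketDoorLPocketDefs`, nsreg-p1 g25 Sketch31D
# 8bb56c0a84466268), plate (P4) BY NAME: `strainRigidity_holds : StrainRigidity`

Seat nsreg-C26-p1 g4 (S-door lane, LEAD ns-s30-p1 g2); `--supports stmt-NavierStokesRegularity-0056 --as helper`.
The wrapper of `QuietScarPocketDoorStrainRigidity.curl_eq_zero_of_killing_offApex` (Killing fields off the apex with decaying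
gradient have `∇V ≡ 0`, hence are irrotational) in the schema's vocabulary: `strainCLM (∇V) = 0` unfolds entrywise by
`strainCLM_apply`.  With (P1) `LPocketZoom strainCLM`, (P2) `TerminalTraceAnalyticVelocity` and (P3) `FrameTransferL strainCLM`
the instance door `TargetStrainPocket` («a one-point Type-I blow-up STRAINS every pocket at the blow-up time») follows by
`targetStrainPocket_of`.  WHAT THIS IS NOT: a static rigidity input of a corollary schema about HYPOTHETICAL Type-I profiles;
item 0056 `NoTypeII` and Navier–Stokes regularity are NOT proved.  [folklore: Killing fields of `ℝⁿ` are affine]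
-/

noncomputable section

set_option linter.dupNamespace false

namespace Summit.NavierStokesRegularity.NavierStokesRegularity.Theorems.QuietScarPocketDoor

open Set Function Filter Topology Metric
open scoped RealInnerProductSpace InnerProductSpace
open Literature.Analysis Literature.Analysis.FluidPDE

/-- **(P4) STRAIN RIGIDITY by name** (`StrainRigidity := StaticLRigidity strainCLM`): a real-analytic divergence-free field on
`ℝ³∖{0}` with Type-I decay of itself and of its gradient whose symmetrised gradient vanishes off the apex is irrotational off the
apex — by `curl_eq_zero_of_killing_offApex` (only the gradient decay and the Killing identity are used). [folklore] -/
theorem strainRigidity_holds : StrainRigidity := by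
  intro V hA _ hD _ hL y hy
  refine curl_eq_zero_of_killing_offApex hA hD (fun z hz i j => ?_) y hy
  have h := congrFun (congrFun (hL z hz) i) j
  rw [strainCLM_apply] at h
  simpa using h

end Summit.NavierStokesRegularity.NavierStokesRegularity.Theorems.QuietScarPocketDoor

end
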